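import Literature.AlgebraicGeometry.Resolution.StrictTransformFlatteningReduction
import Literature.AlgebraicGeometry.Morphisms.AffineFiniteTypeImmersion
import HarnessLib

/-!
# Raynaud–Gruson flattening (Stacks 081R): reduction to closed subschemes of quasi-compact
# opens of affine space

Topic: `Literature/AlgebraicGeometry/Resolution`. Continuation of
`StrictTransformFlatteningReduction.lean` (reduction of the named fact `Stacks081R` to an affine
source) along the second paragraph of the printed proof of Stacks, Tag 081R: "Assume `X` is
affine. By Morphisms, Lemma 29.39.2 (Tag 04II) we can choose an immersion `j : X → 𝐀ⁿ_S` over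
`S`. […] a quasi-compact open `U' ⊆ 𝐀ⁿ_S` containing `j(X)` such that `j : X → U'` is a closed
immersion. […]" What is then invoked — flattening of the finite type quasi-coherent module
`j_*𝒪_X` on the finitely presented `S`-scheme `U'` by a `U`-admissible blowing up (More on
Flatness, Theorem 38.30.7 = Tag 0815, the theorem of Raynaud–Gruson, Première partie, 5.2.2 for
modules) together with the identification of its strict transform with the structure sheaf of
the strict transform of `X` (Divisors, Lemma 31.33.4 = Tag 080G) — is isolated here as the
explicit hypothesis of

* `stacks081R_of_embedded` — **`Stacks081R` follows from its case of a closed subscheme `X` of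
  a quasi-compact open `U'` of an affine space `𝐀^ι_S` (`ι` finite), with structure morphism
  `X → U' ⊆ 𝐀^ι_S → S`.**

Ingredients, all proved: the reduction to affine `X` (`stacks081R_of_affine`); the immersion
`X → 𝐀^ι_S` over `S` for `X` affine of finite type over `S` (Stacks 04II,
`Literature.AlgebraicGeometry.Morphisms.exists_isImmersion_comp_eq_of_isAffine`); and the
shrinking of the open part of an immersion with quasi-compact source to a quasi-compact open
(`exists_isClosedImmersion_lift_of_isImmersion`: the image is compact and locally closed, so it
is closed in a finite union of affine opens of the open in which it is closed).

## References

* The Stacks Project, Tag 081R (More on Flatness, Lemma 38.31.1), proof, second paragraph;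
  Tag 04II; Tag 0815; Tag 080G. [StacksProject]
* M. Raynaud, L. Gruson, *Critères de platitude et de projectivité*, Invent. Math. 13 (1971),
  Première partie, 5.2. [RaynaudGruson1971]
-/

noncomputable section

open CategoryTheory CategoryTheory.Limits AlgebraicGeometry TopologicalSpace Topology

namespace Literature.AlgebraicGeometry.Resolution

universe u

open Literature.AlgebraicGeometry.Morphisms

/-- **A compact subset of an open subset of a scheme lies in a quasi-compact open subset of
it** (finite union of affine opens). [folklore] -/
theorem exists_isCompact_open_between {Y : Scheme.{u}} {K : Set Y} (hK : IsCompact K)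
    (C : Y.Opens) (hKC : K ⊆ C) :
    ∃ U : Y.Opens, IsCompact (U : Set Y) ∧ K ⊆ U ∧ U ≤ C := by
  classical
  have hx : ∀ x : K, ∃ A : Y.Opens, IsAffineOpen A ∧ (x : Y) ∈ A ∧ A ≤ C := fun x => by
    obtain ⟨A, hA, hxA, hAC⟩ := exists_isAffineOpen_mem_and_subset (X := Y) (x := (x : Y))
      (U := C) (hKC x.2)
    exact ⟨A, hA, hxA, hAC⟩
  choose A hA hxA hAC using hx
  obtain ⟨t, ht⟩ := hK.elim_finite_subcover (fun x : K => (A x : Set Y)) (fun x => (A x).2)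
    fun x hx => Set.mem_iUnion.mpr ⟨⟨x, hx⟩, hxA ⟨x, hx⟩⟩
  refine ⟨⨆ x ∈ t, A x, ?_, fun x hx => ?_, iSup₂_le fun x _ => hAC x⟩
  · simp only [Opens.iSup_mk, Opens.carrier_eq_coe, Opens.coe_mk]
    exact t.isCompact_biUnion fun x _ => (hA x).isCompact
  · simp only [Opens.iSup_mk, Opens.carrier_eq_coe, Opens.coe_mk]
    exact ht hx

/-- **An immersion with quasi-compact source is a closed immersion into a quasi-compact open of
the target.** [cite: StacksProject, Tag 081R (proof)] -/
theorem exists_isClosedImmersion_lift_of_isImmersion {X Y : Scheme.{u}} [CompactSpace X]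
    (i : X ⟶ Y) [IsImmersion i] :
    ∃ (U : Y.Opens) (c : X ⟶ U), IsCompact (U : Set Y) ∧ IsClosedImmersion c ∧ c ≫ U.ι = i := by
  obtain ⟨U, hUc, hrange, hUC⟩ := exists_isCompact_open_between (isCompact_range i.continuous)
    i.coborderRange (fun y hy => subset_coborder hy)
  have hrange' : Set.range i ⊆ Set.range U.ι := by rwa [Scheme.Opens.range_ι]
  have hfac := IsOpenImmersion.lift_fac U.ι i hrange'
  refine ⟨U, IsOpenImmersion.lift U.ι i hrange', hUc, ?_, hfac⟩
  haveI : IsImmersion (IsOpenImmersion.lift U.ι i hrange' ≫ U.ι) := by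
    rw [hfac]
    infer_instance
  haveI : IsImmersion (IsOpenImmersion.lift U.ι i hrange') := IsImmersion.of_comp _ U.ι
  refine IsClosedImmersion.of_isPreimmersion _ ?_
  -- the range of the lift is the trace of the closure of `range i`
  have hr : Set.range (IsOpenImmersion.lift U.ι i hrange') = U.ι ⁻¹' closure (Set.range i) := by
    ext y
    have hyU : (U.ι y : Y) ∈ coborder (Set.range i) := by
      refine hUC ?_
      show U.ι y ∈ (U : Set Y)
      rw [← Scheme.Opens.range_ι]
      exact ⟨y, rfl⟩
    constructor
    · rintro ⟨x, rfl⟩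
      refine subset_closure ⟨x, ?_⟩
      rw [← Scheme.Hom.comp_apply, hfac]
    · intro (hy : U.ι y ∈ closure (Set.range i))
      have hy' : U.ι y ∈ coborder (Set.range i) ∩ closure (Set.range i) := ⟨hyU, hy⟩
      rw [coborder_inter_closure] at hy'
      obtain ⟨x, hx⟩ := hy'
      refine ⟨x, U.ι.isOpenEmbedding.injective ?_⟩
      rw [← Scheme.Hom.comp_apply, hfac, hx]
  rw [hr]
  exact isClosed_closure.preimage U.ι.continuous

/-- **Raynaud–Gruson flattening (Stacks, Tag 081R) follows from its case of closed subschemes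
of quasi-compact opens of affine spaces.** Suppose that for every quasi-compact and
quasi-separated `S`, every finite `ι`, every quasi-compact open `U' ⊆ 𝐀^ι_S`, every closed
immersion `c : X → U'` (structure morphism `f = (X → U' ⊆ 𝐀^ι_S → S)`) and every quasi-compact
open `U ⊆ S` over which `f` is flat and locally of finite presentation, there are an ideal sheaf
`𝓘` of finite type on `S` with support disjoint from `U` and a blowing up `b : S' → S` in `𝓘`
such that the strict transform of `X` along `b` is flat and locally of finite presentation over
`S'` — which is what Stacks 0815 (flattening of the module `c_*𝒪_X` on the finitely presented
`S`-scheme `U'`) and Stacks 080G (its strict transform is the structure sheaf of the strict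
transform of `X`) provide. Then `Stacks081R` holds: by `stacks081R_of_affine` we may take `X`
affine, when `X → S` factors as an immersion into `𝐀^ι_S` (Stacks 04II), i.e. a closed
immersion into a quasi-compact open `U'` of it (`X` being quasi-compact).
[cite: StacksProject, Tag 081R (proof, ¶2)] -/
theorem stacks081R_of_embedded
    (h : ∀ ⦃S : Scheme.{u}⦄ [CompactSpace S] [QuasiSeparatedSpace S] (ι : Type u) [Finite ι]
      (U' : (𝔸(ι; S)).Opens), IsCompact (U' : Set (𝔸(ι; S) : Scheme.{u})) →
      ∀ ⦃X : Scheme.{u}⦄ (c : X ⟶ U') [IsClosedImmersion c] (U : S.Opens), IsCompact (U : Set S) →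
      Flat ((c ≫ U'.ι ≫ (𝔸(ι; S) ↘ S)) ∣_ U) →
      LocallyOfFinitePresentation ((c ≫ U'.ι ≫ (𝔸(ι; S) ↘ S)) ∣_ U) →
      ∃ (I : S.IdealSheafData) (S' : Scheme.{u}) (b : S' ⟶ S),
        (∀ W : S.affineOpens, (I.ideal W).FG) ∧ Disjoint (U : Set S) (I.support : Set S) ∧
        IsBlowup b I ∧ Flat (blowupStrictTransformMap (c ≫ U'.ι ≫ (𝔸(ι; S) ↘ S)) b I) ∧
        LocallyOfFinitePresentation (blowupStrictTransformMap (c ≫ U'.ι ≫ (𝔸(ι; S) ↘ S)) b I)) :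
    Stacks081R.{u} := by
  refine stacks081R_of_affine fun X S f _ _ _ _ _ _ U hU hflat hlfp => ?_
  obtain ⟨ι, _, i, hi, hiπ⟩ := exists_isImmersion_comp_eq_of_isAffine f
  haveI := hi
  obtain ⟨U', c, hU'c, hc, hcfac⟩ := exists_isClosedImmersion_lift_of_isImmersion i
  haveI := hc
  have hf : c ≫ U'.ι ≫ (𝔸(ι; S) ↘ S) = f := by rw [← Category.assoc, hcfac, hiπ]
  subst hf
  exact h ι U' hU'c c U hU hflat hlfp

end Literature.AlgebraicGeometry.Resolution

end
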